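import Summits.KontsevichZagierPeriods.KontsevichZagierPeriods.Theses.TerasomaMultiplication
import Summits.KontsevichZagierPeriods.KontsevichZagierPeriods.Theorems.MultiplicationAccessible.Negative.Core
import Literature.NumberTheory.Transcendental.KZCalculusProofs
import Literature.NumberTheory.Transcendental.KZLogCalculusProofs
import Literature.NumberTheory.Transcendental.KZRelationsLE
import Literature.NumberTheory.Transcendental.KZProductIdeal
import Literature.NumberTheory.Transcendental.KZMellinFibres
import Literature.NumberTheory.Transcendental.KZSubcalculusInvariants

/-!
# `MultiplicationAccessible` (stmt-KontsevichZagierPeriods-12305, route TerasomaMultiplication) —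
line `shifted-family-prime-sieve`: SKELETON

The crux: for every `m ≥ 1` (`n = m + 1`) and rational `s > 0`, the box representation
`[(0,1)^m, ∏ᵢ xᵢ^((i+1)/n − 1)(1 − xᵢ)^(s−1)]` of `∏_{k=1}^{m} B(k/n, s)` and the simplex
representation `[{σ > 0, Σσ < n}, (∏σⱼ·(n − Σσⱼ))^(s−1)]` of `n^{ns−1}Γ(s)^n/Γ(ns)` are equivalent
in the Kontsevich–Zagier calculus of moves.

Line (card `Cruxes/MultiplicationAccessible/Ideas/shifted-family-prime-sieve.md`): replace the
one-parameter family of the crux by the TWO-PARAMETER SHIFTED FAMILY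
`GM(n; x, s) : ∏_{k<n} B(x + k/n, s) = n^{ns} B(nx, ns) ∏_{j=1}^{n−1} B(js, s)` as an equivalence
of two `n`-dimensional Beta boxes (`GM m x s` below, `n = m + 1`). Then

* `GM` is MULTIPLICATIVE IN `n` inside the rules (`stub_multiplicativityGlue`, from the
  2-dimensional Dirichlet re-association move `stub_betaReassoc`): block re-indexing
  `k = k₂ + n₂k₁`, `GM(n₁)` blockwise, `GM(n₂)` at `(n₁x, n₁s)`, and the "caterpillar" identity
  `⊗ᵢ β(i n₁ s, n₁ s) ⊗ [⊗ⱼ β(js, s)]^{⊗n₂} ~ ⊗_{j<n} β(js, s)` by tree rotations;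
* `GM(2; x, s)` is an explicit chain (`stub_dupSymmetrise`: two Kummer dilations + swap
  symmetrisation + torsion-freeness; `stub_dupPhi`: ONE change of variables along the bijection
  `Φ(η₀,η₁) = (η₀η₁, (1−η₀)(1+η₁)/(2(1−η₀η₁)))` of the open box);
* `GM(p; x, s)` for odd primes `p` is the open stub `stub_oddPrimeShifted` (held by the lead);
* the BRIDGE back to the crux at `x = 1/n`: strip the value-`1/s` factors by two Newton–Leibniz
  moves and rescale (`stub_stripBridge`), then convert the Beta box `n^{ns−1} ⊗ⱼ β((j+1)s, s)` into
  the crux's simplex representation by the Dirichlet chart (`stub_dirichletSimplex`).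

`MultiplicationAccessible_of` composes: all `GMAt m` by strong induction on the factorisation of
`m + 1` (`Nat.minFac`), then the bridge, then `Negative.multiplicationAccessible_iff`.
All stubs are stated in tree vocabulary only (no line-local definition occurs in a stub), so that
each lands as a pure-proof helper file; `GM`/`GMAt` are abbreviations used by the composition.

References: Kontsevich–Zagier 2001 §1.2; Andrews–Askey–Roy 1999 Thm 1.5.2 (Gauss multiplication),
Thm 1.8.1 (Dirichlet); Disproof.lean gen 1 (`Negative/Core`: torsion-freeness §3, unfolding §1).
-/

noncomputable section

open MeasureTheory Set
open Literature.NumberTheory.Transcendental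
open Literature.NumberTheory.Transcendental.KZ
open Summit.KontsevichZagierPeriods.KontsevichZagierPeriods.Theses.TerasomaMultiplication
  (MultiplicationAccessible)
open Summit.KontsevichZagierPeriods.MultiplicationAccessible.Negative
  (boxDom boxFun simplexDom simplexFun IsBoxRep IsSimplexRep At multiplicationAccessible_iff)

namespace Summit.KontsevichZagierPeriods.TerasomaMultiplication.MultiplicationAccessible

/-! ## Vocabulary of the line -/

/-- **The shifted Gauss-multiplication family inside the rules**, `n = m + 1`:
`GM m x s` says that every box representation of `∏_{k<n} B(x + k/n, s)` (integrand
`∏ₖ zₖ^(x + k/n − 1)(1 − zₖ)^(s−1)` on `(0,1)^n`) is KZ-equivalent to every box representation of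
`n^{ns} B(nx, ns) ∏_{j=1}^{n−1} B(js, s)` (coordinate `0` the `B(nx, ns)` variable, coordinate
`j.succ` the `B((j+1)s, s)` variable). Value identity: Gauss multiplication in shifted Beta form
(Andrews–Askey–Roy 1999, Thm 1.5.2). [folklore] -/
def GM (m : ℕ) (x s : ℚ) : Prop :=
  ∀ (r r' : IntegralRep (m + 1)),
    r.domain = {z | ∀ i, z i ∈ Set.Ioo (0:ℝ) 1} →
    Set.EqOn r.integrand (fun z => ∏ k : Fin (m + 1),
      (z k) ^ ((x:ℝ) + ((k:ℕ):ℝ) / ((m:ℝ) + 1) - 1) * (1 - z k) ^ ((s:ℝ) - 1)) r.domain →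
    r'.domain = {z | ∀ i, z i ∈ Set.Ioo (0:ℝ) 1} →
    Set.EqOn r'.integrand (fun z => ((m:ℝ) + 1) ^ (((m:ℝ) + 1) * (s:ℝ)) *
      ((z 0) ^ (((m:ℝ) + 1) * (x:ℝ) - 1) * (1 - z 0) ^ (((m:ℝ) + 1) * (s:ℝ) - 1)) *
      ∏ j : Fin m, (z j.succ) ^ ((((j:ℕ):ℝ) + 1) * (s:ℝ) - 1) * (1 - z j.succ) ^ ((s:ℝ) - 1))
      r'.domain →
    Equivalent r r'

/-- `GMAt m`: the shifted family at `n = m + 1` for ALL positive rational `(x, s)`. [folklore] -/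
def GMAt (m : ℕ) : Prop := ∀ (x s : ℚ), 0 < x → 0 < s → GM m x s

/-! ## Registered stubs (tree vocabulary only) -/

/-- STUB (M). Duplication, first half: two Kummer dilations `ξᵢ = ηᵢ²`
(`KZ.of_sub_of_mem_relations_of_boxDilation`), the swap `η₀ ↔ η₁`
(`KZ.of_sub_of_reindex_mem_relations`), integrand additivity and torsion-freeness
(`Negative.mem_relations_of_nsmul_mem_relations`) turn the box representation of
`B(x,s)B(x+½,s)` into the SYMMETRISED Kummer pull-back
`[(0,1)², 2(η₀η₁)^{2x−1}(η₀+η₁)((1−η₀²)(1−η₁²))^{s−1}]`. -/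
theorem stub_dupSymmetrise :
    ∀ (x s : ℚ), 0 < x → 0 < s → ∀ (r : KZ.IntegralRep 2),
      r.domain = {z | ∀ i, z i ∈ Set.Ioo (0:ℝ) 1} →
      Set.EqOn r.integrand (fun z => (z 0) ^ ((x:ℝ) - 1) * (1 - z 0) ^ ((s:ℝ) - 1) *
        ((z 1) ^ ((x:ℝ) - 1/2) * (1 - z 1) ^ ((s:ℝ) - 1))) r.domain →
      ∃ q : KZ.IntegralRep 2, q.domain = {z | ∀ i, z i ∈ Set.Ioo (0:ℝ) 1} ∧
        Set.EqOn q.integrand (fun z => 2 * (z 0 * z 1) ^ (2 * (x:ℝ) - 1) * (z 0 + z 1) *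
          ((1 - z 0 ^ 2) * (1 - z 1 ^ 2)) ^ ((s:ℝ) - 1)) q.domain ∧
        KZ.Equivalent r q := by
  sorry

/-- STUB (M/L). Duplication, second half: ONE change-of-variables move (`KZ.changeOfVariablesRel`)
along the rational bijection `Φ(η₀,η₁) = (η₀η₁, (1−η₀)(1+η₁)/(2(1−η₀η₁)))` of the open box onto
itself (`4(1−ξ₀)²ξ₁(1−ξ₁)∘Φ = (1−η₀²)(1−η₁²)`, `det DΦ = (η₀+η₁)/(2(1−η₀η₁))`, inverse
`η₀η₁ = ξ₀`, `η₀ − η₁ = (1−2ξ₁)(1−ξ₀)`) takes the symmetrised representation to the box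
representation of `4^s B(2x,2s) B(s,s)`. -/
theorem stub_dupPhi :
    ∀ (x s : ℚ), 0 < x → 0 < s → ∀ (q r' : KZ.IntegralRep 2),
      q.domain = {z | ∀ i, z i ∈ Set.Ioo (0:ℝ) 1} →
      Set.EqOn q.integrand (fun z => 2 * (z 0 * z 1) ^ (2 * (x:ℝ) - 1) * (z 0 + z 1) *
        ((1 - z 0 ^ 2) * (1 - z 1 ^ 2)) ^ ((s:ℝ) - 1)) q.domain →
      r'.domain = {z | ∀ i, z i ∈ Set.Ioo (0:ℝ) 1} →
      Set.EqOn r'.integrand (fun z => (4:ℝ) ^ (s:ℝ) * (z 0) ^ (2 * (x:ℝ) - 1) *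
        (1 - z 0) ^ (2 * (s:ℝ) - 1) * ((z 1) ^ ((s:ℝ) - 1) * (1 - z 1) ^ ((s:ℝ) - 1))) r'.domain →
      KZ.Equivalent q r' := by
  sorry

/-- STUB (M/L). Dirichlet re-association `B(a,b)B(a+b,c) = B(b,c)B(a,b+c)` as an equivalence of
2-dimensional Beta boxes: two change-of-variables moves onto the open simplex
`{t₁, t₂ > 0, t₁ + t₂ < 1}` with integrand `t₁^{a−1}t₂^{b−1}(1−t₁−t₂)^{c−1}` — `(u,v) ↦ (uv, (1−u)v)`
(Jacobian `v`) and `(u,v) ↦ (v, u(1−v))` (Jacobian `1−v`) (Andrews–Askey–Roy 1999, Thm 1.8.1). -/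
theorem stub_betaReassoc :
    ∀ (a b c : ℚ), 0 < a → 0 < b → 0 < c → ∀ (r r' : KZ.IntegralRep 2),
      r.domain = {z | ∀ i, z i ∈ Set.Ioo (0:ℝ) 1} →
      Set.EqOn r.integrand (fun z => (z 0) ^ ((a:ℝ) - 1) * (1 - z 0) ^ ((b:ℝ) - 1) *
        ((z 1) ^ ((a:ℝ) + (b:ℝ) - 1) * (1 - z 1) ^ ((c:ℝ) - 1))) r.domain →
      r'.domain = {z | ∀ i, z i ∈ Set.Ioo (0:ℝ) 1} →
      Set.EqOn r'.integrand (fun z => (z 0) ^ ((b:ℝ) - 1) * (1 - z 0) ^ ((c:ℝ) - 1) *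
        ((z 1) ^ ((a:ℝ) - 1) * (1 - z 1) ^ ((b:ℝ) + (c:ℝ) - 1))) r'.domain →
      KZ.Equivalent r r' := by
  sorry

/-- STUB (L). The multiplicativity glue: given the Dirichlet re-association move (hypothesis, =
`stub_betaReassoc`), `GM` at `n₁ = a + 1` and at `n₂ = b + 1` (all `x, s`) give `GM` at
`n = n₁n₂ = (a*b + a + b) + 1` — block re-indexing `k = k₂ + n₂ k₁` (`x + k/n = (x + k₂/n) + k₁/n₁`),
`GM(n₁)` on each block, `GM(n₂)` at `(n₁x, n₁s)` on the collected first coordinates, constants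
`n₁^{ns} n₂^{ns} = n^{ns}`, and the caterpillar identity by re-association (tree rotations);
products / reindexing / scaling by `KZ.Equivalent.prod`, `KZ.of_sub_of_reindex_mem_relations`,
`KZ.Equivalent.constMul` (all proved in the tree). Cancellation-free. -/
theorem stub_multiplicativityGlue :
    (∀ (a b c : ℚ), 0 < a → 0 < b → 0 < c → ∀ (r r' : KZ.IntegralRep 2),
      r.domain = {z | ∀ i, z i ∈ Set.Ioo (0:ℝ) 1} →
      Set.EqOn r.integrand (fun z => (z 0) ^ ((a:ℝ) - 1) * (1 - z 0) ^ ((b:ℝ) - 1) *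
        ((z 1) ^ ((a:ℝ) + (b:ℝ) - 1) * (1 - z 1) ^ ((c:ℝ) - 1))) r.domain →
      r'.domain = {z | ∀ i, z i ∈ Set.Ioo (0:ℝ) 1} →
      Set.EqOn r'.integrand (fun z => (z 0) ^ ((b:ℝ) - 1) * (1 - z 0) ^ ((c:ℝ) - 1) *
        ((z 1) ^ ((a:ℝ) - 1) * (1 - z 1) ^ ((b:ℝ) + (c:ℝ) - 1))) r'.domain →
      KZ.Equivalent r r') →
    ∀ a b : ℕ,
      (∀ (x s : ℚ), 0 < x → 0 < s → ∀ (r r' : KZ.IntegralRep (a + 1)),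
        r.domain = {z | ∀ i, z i ∈ Set.Ioo (0:ℝ) 1} →
        Set.EqOn r.integrand (fun z => ∏ k : Fin (a + 1),
          (z k) ^ ((x:ℝ) + ((k:ℕ):ℝ) / ((a:ℝ) + 1) - 1) * (1 - z k) ^ ((s:ℝ) - 1)) r.domain →
        r'.domain = {z | ∀ i, z i ∈ Set.Ioo (0:ℝ) 1} →
        Set.EqOn r'.integrand (fun z => ((a:ℝ) + 1) ^ (((a:ℝ) + 1) * (s:ℝ)) *
          ((z 0) ^ (((a:ℝ) + 1) * (x:ℝ) - 1) * (1 - z 0) ^ (((a:ℝ) + 1) * (s:ℝ) - 1)) *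
          ∏ j : Fin a, (z j.succ) ^ ((((j:ℕ):ℝ) + 1) * (s:ℝ) - 1) * (1 - z j.succ) ^ ((s:ℝ) - 1))
          r'.domain →
        KZ.Equivalent r r') →
      (∀ (x s : ℚ), 0 < x → 0 < s → ∀ (r r' : KZ.IntegralRep (b + 1)),
        r.domain = {z | ∀ i, z i ∈ Set.Ioo (0:ℝ) 1} →
        Set.EqOn r.integrand (fun z => ∏ k : Fin (b + 1),
          (z k) ^ ((x:ℝ) + ((k:ℕ):ℝ) / ((b:ℝ) + 1) - 1) * (1 - z k) ^ ((s:ℝ) - 1)) r.domain →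
        r'.domain = {z | ∀ i, z i ∈ Set.Ioo (0:ℝ) 1} →
        Set.EqOn r'.integrand (fun z => ((b:ℝ) + 1) ^ (((b:ℝ) + 1) * (s:ℝ)) *
          ((z 0) ^ (((b:ℝ) + 1) * (x:ℝ) - 1) * (1 - z 0) ^ (((b:ℝ) + 1) * (s:ℝ) - 1)) *
          ∏ j : Fin b, (z j.succ) ^ ((((j:ℕ):ℝ) + 1) * (s:ℝ) - 1) * (1 - z j.succ) ^ ((s:ℝ) - 1))
          r'.domain →
        KZ.Equivalent r r') →
      (∀ (x s : ℚ), 0 < x → 0 < s → ∀ (r r' : KZ.IntegralRep (a * b + a + b + 1)),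
        r.domain = {z | ∀ i, z i ∈ Set.Ioo (0:ℝ) 1} →
        Set.EqOn r.integrand (fun z => ∏ k : Fin (a * b + a + b + 1),
          (z k) ^ ((x:ℝ) + ((k:ℕ):ℝ) / (((a * b + a + b : ℕ):ℝ) + 1) - 1) *
            (1 - z k) ^ ((s:ℝ) - 1)) r.domain →
        r'.domain = {z | ∀ i, z i ∈ Set.Ioo (0:ℝ) 1} →
        Set.EqOn r'.integrand (fun z => (((a * b + a + b : ℕ):ℝ) + 1) ^
            ((((a * b + a + b : ℕ):ℝ) + 1) * (s:ℝ)) *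
          ((z 0) ^ ((((a * b + a + b : ℕ):ℝ) + 1) * (x:ℝ) - 1) *
            (1 - z 0) ^ ((((a * b + a + b : ℕ):ℝ) + 1) * (s:ℝ) - 1)) *
          ∏ j : Fin (a * b + a + b), (z j.succ) ^ ((((j:ℕ):ℝ) + 1) * (s:ℝ) - 1) *
            (1 - z j.succ) ^ ((s:ℝ) - 1)) r'.domain →
        KZ.Equivalent r r') := by
  sorry

/-- STUB (L). The bridge, first half, at `x = 1/n`: from `GM m (1/n) s` and the two Newton–Leibniz
strips of the value-`1/s` factors (`∫₀¹(1−t)^{s−1}dt = 1/s` on the last left coordinate — exponent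
`1/n + m/n − 1 = 0` —, `∫₀¹ n^{ns}(1−t)^{ns−1}dt = n^{ns−1}/s` on the first right coordinate, moved
last by a coordinate permutation), rescaled by `KZ.scale s`: the crux's box representation is
equivalent to the Beta box `[(0,1)^m, n^{ns−1} ∏ⱼ zⱼ^{(j+1)s−1}(1−zⱼ)^{s−1}]`, which exists. -/
theorem stub_stripBridge :
    ∀ (m : ℕ) (s : ℚ), 1 ≤ m → 0 < s →
      (∀ (r r' : KZ.IntegralRep (m + 1)),
        r.domain = {z | ∀ i, z i ∈ Set.Ioo (0:ℝ) 1} →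
        Set.EqOn r.integrand (fun z => ∏ k : Fin (m + 1),
          (z k) ^ ((((1 / ((m:ℚ) + 1) : ℚ)):ℝ) + ((k:ℕ):ℝ) / ((m:ℝ) + 1) - 1) *
            (1 - z k) ^ ((s:ℝ) - 1)) r.domain →
        r'.domain = {z | ∀ i, z i ∈ Set.Ioo (0:ℝ) 1} →
        Set.EqOn r'.integrand (fun z => ((m:ℝ) + 1) ^ (((m:ℝ) + 1) * (s:ℝ)) *
          ((z 0) ^ (((m:ℝ) + 1) * (((1 / ((m:ℚ) + 1) : ℚ)):ℝ) - 1) *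
            (1 - z 0) ^ (((m:ℝ) + 1) * (s:ℝ) - 1)) *
          ∏ j : Fin m, (z j.succ) ^ ((((j:ℕ):ℝ) + 1) * (s:ℝ) - 1) * (1 - z j.succ) ^ ((s:ℝ) - 1))
          r'.domain →
        KZ.Equivalent r r') →
      ∀ (r : KZ.IntegralRep m), r.domain = {z | ∀ i, z i ∈ Set.Ioo (0:ℝ) 1} →
        Set.EqOn r.integrand (fun z => ∏ i : Fin m,
          (z i) ^ ((((i:ℕ):ℝ) + 1) / ((m:ℝ) + 1) - 1) * (1 - z i) ^ ((s:ℝ) - 1)) r.domain →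
        ∃ q : KZ.IntegralRep m, q.domain = {z | ∀ i, z i ∈ Set.Ioo (0:ℝ) 1} ∧
          Set.EqOn q.integrand (fun z => ((m:ℝ) + 1) ^ (((m:ℝ) + 1) * (s:ℝ) - 1) *
            ∏ j : Fin m, (z j) ^ ((((j:ℕ):ℝ) + 1) * (s:ℝ) - 1) * (1 - z j) ^ ((s:ℝ) - 1))
            q.domain ∧
          KZ.Equivalent r q := by
  sorry

/-- STUB (L). The bridge, second half: the Beta box `[(0,1)^m, n^{ns−1} ∏ⱼ zⱼ^{(j+1)s−1}(1−zⱼ)^{s−1}]`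
is equivalent to the crux's simplex representation `[{σ > 0, Σσ < n}, (∏σⱼ(n − Σσⱼ))^{s−1}]`:
coordinate reversal + reflections `zⱼ ↦ 1 − zⱼ` (`KZ.of_sub_of_mem_relations_of_boxReflection`) +
ONE change of variables along the Dirichlet chart `σ = n·(u₁, (1−u₁)u₂, …, ∏_{i<m}(1−uᵢ)·u_m)`
(triangular Jacobian `n^m ∏ⱼ(1−uⱼ)^{m−j}`; Andrews–Askey–Roy 1999 Thm 1.8.1; the case `m = 2` is
`MultiplicationThree/Negative/BoxToBox.lean`). -/
theorem stub_dirichletSimplex :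
    ∀ (m : ℕ) (s : ℚ), 1 ≤ m → 0 < s → ∀ (q r' : KZ.IntegralRep m),
      q.domain = {z | ∀ i, z i ∈ Set.Ioo (0:ℝ) 1} →
      Set.EqOn q.integrand (fun z => ((m:ℝ) + 1) ^ (((m:ℝ) + 1) * (s:ℝ) - 1) *
        ∏ j : Fin m, (z j) ^ ((((j:ℕ):ℝ) + 1) * (s:ℝ) - 1) * (1 - z j) ^ ((s:ℝ) - 1)) q.domain →
      r'.domain = {x | (∀ i, 0 < x i) ∧ ∑ i, x i < (m:ℝ) + 1} →
      Set.EqOn r'.integrand (fun x => ((∏ i, x i) * ((m:ℝ) + 1 - ∑ i, x i)) ^ ((s:ℝ) - 1))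
        r'.domain →
      KZ.Equivalent q r' := by
  sorry

/-- STUB (XL, held by the lead). `GM` at every ODD PRIME `p = m + 1 ≥ 3`, with `x` free: the
residual of the line. No chain is known; candidate mechanisms are Terasoma's covering in
DFT∘Vieta / rays-cell coordinates (cards fourier-vieta-transposition, join-the-rays-cell) run in
the shifted family, or a real-variable transposition of the finite-field proofs of the
Davenport–Hasse product relation (Greene–Stanton 1986 for `p = 3`). -/
theorem stub_oddPrimeShifted :
    ∀ p : ℕ, p.Prime → 3 ≤ p →
      ∀ (x s : ℚ), 0 < x → 0 < s → ∀ (r r' : KZ.IntegralRep (p - 1 + 1)),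
        r.domain = {z | ∀ i, z i ∈ Set.Ioo (0:ℝ) 1} →
        Set.EqOn r.integrand (fun z => ∏ k : Fin (p - 1 + 1),
          (z k) ^ ((x:ℝ) + ((k:ℕ):ℝ) / (((p - 1 : ℕ):ℝ) + 1) - 1) * (1 - z k) ^ ((s:ℝ) - 1))
          r.domain →
        r'.domain = {z | ∀ i, z i ∈ Set.Ioo (0:ℝ) 1} →
        Set.EqOn r'.integrand (fun z => (((p - 1 : ℕ):ℝ) + 1) ^ ((((p - 1 : ℕ):ℝ) + 1) * (s:ℝ)) *
          ((z 0) ^ ((((p - 1 : ℕ):ℝ) + 1) * (x:ℝ) - 1) *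
            (1 - z 0) ^ ((((p - 1 : ℕ):ℝ) + 1) * (s:ℝ) - 1)) *
          ∏ j : Fin (p - 1), (z j.succ) ^ ((((j:ℕ):ℝ) + 1) * (s:ℝ) - 1) *
            (1 - z j.succ) ^ ((s:ℝ) - 1)) r'.domain →
        KZ.Equivalent r r' := by
  sorry

/-! ## Composition -/

/-- Folded forms of the stubs. [folklore] -/
theorem gmAt_glue (a b : ℕ) (ha : GMAt a) (hb : GMAt b) : GMAt (a * b + a + b) :=
  stub_multiplicativityGlue stub_betaReassoc a b ha hb

/-- Folded form of the prime stub. [folklore] -/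
theorem gmAt_prime (p : ℕ) (hp : p.Prime) (h3 : 3 ≤ p) : GMAt (p - 1) :=
  stub_oddPrimeShifted p hp h3

/-- `GM` at `n = 1` is the empty statement `B(x,s) = 1^s B(x,s)`: both integrands agree on the box
(congruence, `KZ.of_sub_of_mem_relations_of_eqOn`). [folklore] -/
theorem gmAt_zero : GMAt 0 := by
  intro x s hx hs r r' hr hri hr' hri'
  refine of_sub_of_mem_relations_of_eqOn (by rw [hr, hr']) fun z hz => ?_
  have hz' : z ∈ r'.domain := by rw [hr', ← hr]; exact hz
  rw [hri hz, hri' hz']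
  norm_num [Fin.prod_univ_one]
  rw [Fin.prod_univ_one]

/-- The integrand of `GM 1 x s` on the left, written out on `(0,1)²`. [folklore] -/
theorem gmLeft_one_eq (x s : ℚ) (z : Fin 2 → ℝ) :
    (∏ k : Fin (1 + 1), (z k) ^ ((x:ℝ) + ((k:ℕ):ℝ) / (((1:ℕ):ℝ) + 1) - 1) *
        (1 - z k) ^ ((s:ℝ) - 1)) =
      (z 0) ^ ((x:ℝ) - 1) * (1 - z 0) ^ ((s:ℝ) - 1) *
        ((z 1) ^ ((x:ℝ) - 1/2) * (1 - z 1) ^ ((s:ℝ) - 1)) := by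
  rw [Fin.prod_univ_two]
  have h0 : ((x:ℝ) + (((0 : Fin (1 + 1)) : ℕ):ℝ) / (((1:ℕ):ℝ) + 1) - 1) = (x:ℝ) - 1 := by
    norm_num
  have h1 : ((x:ℝ) + (((1 : Fin (1 + 1)) : ℕ):ℝ) / (((1:ℕ):ℝ) + 1) - 1) = (x:ℝ) - 1/2 := by
    norm_num; ring
  rw [h0, h1]

/-- The integrand of `GM 1 x s` on the right, written out on `(0,1)²` (`2^{2s} = 4^s`). [folklore] -/
theorem gmRight_one_eq (x s : ℚ) (z : Fin 2 → ℝ) :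
    (((1:ℕ):ℝ) + 1) ^ ((((1:ℕ):ℝ) + 1) * (s:ℝ)) *
        ((z 0) ^ ((((1:ℕ):ℝ) + 1) * (x:ℝ) - 1) * (1 - z 0) ^ ((((1:ℕ):ℝ) + 1) * (s:ℝ) - 1)) *
        ∏ j : Fin 1, (z j.succ) ^ ((((j:ℕ):ℝ) + 1) * (s:ℝ) - 1) * (1 - z j.succ) ^ ((s:ℝ) - 1) =
      (4:ℝ) ^ (s:ℝ) * (z 0) ^ (2 * (x:ℝ) - 1) * (1 - z 0) ^ (2 * (s:ℝ) - 1) *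
        ((z 1) ^ ((s:ℝ) - 1) * (1 - z 1) ^ ((s:ℝ) - 1)) := by
  have h4 : ((2:ℝ)) ^ ((2:ℝ) * (s:ℝ)) = (4:ℝ) ^ (s:ℝ) := by
    rw [Real.rpow_mul (by norm_num : (0:ℝ) ≤ 2)]
    norm_num
  rw [Fin.prod_univ_one]
  have e6 : (((1:ℕ):ℝ) + 1) = (2:ℝ) := by norm_num
  have e7 : ((((0 : Fin 1) : ℕ):ℝ) + 1) = (1:ℝ) := by norm_num
  have e8 : ((0 : Fin 1).succ : Fin (1 + 1)) = 1 := rfl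
  simp only [e6, e7, e8, one_mul, h4]
  ring

/-- **`GM` at `n = 2` for all `(x, s)`** from the two duplication stubs. [folklore] -/
theorem gmAt_one : GMAt 1 := by
  intro x s hx hs r r' hr hri hr' hri'
  have hri₂ : Set.EqOn r.integrand (fun z => (z 0) ^ ((x:ℝ) - 1) * (1 - z 0) ^ ((s:ℝ) - 1) *
      ((z 1) ^ ((x:ℝ) - 1/2) * (1 - z 1) ^ ((s:ℝ) - 1))) r.domain := fun z hz => by
    rw [hri hz]
    exact gmLeft_one_eq x s z
  have hri₂' : Set.EqOn r'.integrand (fun z => (4:ℝ) ^ (s:ℝ) * (z 0) ^ (2 * (x:ℝ) - 1) *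
      (1 - z 0) ^ (2 * (s:ℝ) - 1) * ((z 1) ^ ((s:ℝ) - 1) * (1 - z 1) ^ ((s:ℝ) - 1)))
      r'.domain := fun z hz => by
    rw [hri' hz]
    exact gmRight_one_eq x s z
  obtain ⟨q, hqd, hqi, hrq⟩ := stub_dupSymmetrise x s hx hs r hr hri₂
  exact hrq.trans (stub_dupPhi x s hx hs q r' hqd hqi hr' hri₂')

/-- **`GM` for every `n`**: strong induction on `m`, splitting `n = m + 1` into `1`, the primes
`2`, `p ≥ 3`, and composites `n = p · (n/p)` (`p = Nat.minFac n`) handled by the glue. [folklore] -/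
theorem gmAt_all : ∀ m : ℕ, GMAt m := by
  intro m
  induction m using Nat.strong_induction_on with
  | _ m ih =>
    rcases Nat.eq_zero_or_pos m with rfl | hm
    · exact gmAt_zero
    by_cases hprime : (m + 1).Prime
    · by_cases h2 : m + 1 = 2
      · have : m = 1 := by omega
        subst this
        exact gmAt_one
      · have h3 : 3 ≤ m + 1 := by
          have := hprime.two_le
          omega
        have := gmAt_prime (m + 1) hprime h3
        simpa using this
    · -- composite: `m + 1 = p * q` with `p = minFac (m+1)` prime and `2 ≤ q < m + 1`
      obtain ⟨p, hp⟩ : ∃ p, p = (m + 1).minFac := ⟨_, rfl⟩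
      have hpprime : p.Prime := hp ▸ Nat.minFac_prime (by omega)
      have hpdvd : p ∣ m + 1 := hp ▸ Nat.minFac_dvd (m + 1)
      obtain ⟨q, hq⟩ := hpdvd
      have hp2 : 2 ≤ p := hpprime.two_le
      have hq0 : q ≠ 0 := by
        rintro rfl
        simp at hq
      have hq1 : q ≠ 1 := by
        rintro rfl
        rw [mul_one] at hq
        exact hprime (hq ▸ hpprime)
      have hq2 : 2 ≤ q := by omega
      have hpn : p < m + 1 := by
        rw [hq]
        exact lt_mul_of_one_lt_right (by omega) (by omega)
      have hqn : q < m + 1 := by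
        rw [hq]
        exact lt_mul_of_one_lt_left (by omega) (by omega)
      have hpm : p - 1 < m := by omega
      have hqm : q - 1 < m := by omega
      -- `m = (p-1)*(q-1) + (p-1) + (q-1)`
      have hm' : (p - 1) * (q - 1) + (p - 1) + (q - 1) = m := by
        have h1 : (p - 1) * (q - 1) + (p - 1) + (q - 1) + 1 = p * q := by
          cases p with
          | zero => omega
          | succ p' =>
            cases q with
            | zero => omega
            | succ q' => simp; ring
        omega
      have ha := ih (p - 1) hpm
      have hb := ih (q - 1) hqm
      rw [← hm']
      exact gmAt_glue (p - 1) (q - 1) ha hb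

/-- **The crux from the line** (`Summit.…TerasomaMultiplication.MultiplicationAccessible`):
`GM m (1/n) s` for every `m` (`gmAt_all`), the strip/rescale bridge to the Beta box
(`stub_stripBridge`), and the Dirichlet conversion of that box into the simplex representation
(`stub_dirichletSimplex`), assembled through `Negative.multiplicationAccessible_iff`. -/
theorem MultiplicationAccessible_of : MultiplicationAccessible := by
  rw [multiplicationAccessible_iff]
  intro m s hm hs r r' hr hr'
  have hx : (0:ℚ) < 1 / ((m:ℚ) + 1) := by positivity
  have hGM : GM m (1 / ((m:ℚ) + 1)) s := gmAt_all m _ s hx hs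
  obtain ⟨q, hqd, hqi, hrq⟩ := stub_stripBridge m s hm hs hGM r hr.1 hr.2
  exact hrq.trans (stub_dirichletSimplex m s hm hs q r' hqd hqi hr'.1 hr'.2)

end Summit.KontsevichZagierPeriods.TerasomaMultiplication.MultiplicationAccessible

end
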